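import Mathlib
import Summits.NavierStokesRegularity.NavierStokesRegularity.Theorems.FilamentSkeletonRssStadiumChordVariance
import Summits.NavierStokesRegularity.NavierStokesRegularity.Theorems.FilamentSkeletonRssStadiumCauchyNumerator
import Summits.NavierStokesRegularity.NavierStokesRegularity.Theorems.FilamentSkeletonRssStadiumPartnerPiece

/-!
# Route `FilamentSkeletonRss` · child crux `TangentSkeletonNearStraightL` (stmt-NavierStokesRegularity-23320) · registered line
# `child_tangent_analytic_strip_L` (b0b56c52900dd90a), stub `stub_stripPropagation` — assembly piece: SHORT PLATEAU CHORDS IN THE STADIUM, EVERY `Rb`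

First assembly piece of the quarter-width blueprint (evidence `CORNER-QUARTER-BLUEPRINT-leafhand-15-g0.md` on 23320), in the stub's own terms
(rectangle stadium `S = {|Im z| < hs, |Re z − cc| < L + hs}`, `F : ℂ → ℂ³` holomorphic on `S`, `‖F′‖ ≤ M` on `S`, bilinear unit speed
`Σ (F′)ᵢ² = 1`): for a target `z` and a horizontal displacement `s` such that the closed `d`-discs about the whole chord `[z, z+s]` stay in `S`,
the Cauchy estimate `‖F″‖ ≤ M/d` (`Theorems.StadiumCauchyNumerator.norm_deriv_deriv_le_of_closedBall`) and the second-order chord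
(`Theorems.StadiumChordVariance.chord_sq_sub_sq_norm_le_of_deriv_deriv_real`) give
  `‖Σᵢ (Fᵢ(z+s) − Fᵢ(z))² − s²‖ ≤ (M²/(4d²))·s⁴`  and  `Re(Σᵢ (Fᵢ(z+s) − Fᵢ(z))² + κ·G) ≥ s²·(1 − M²s²/(4d²)) + κ·g₀`
— the matched kernel is on its principal branch for every chord with `M·|s| ≤ 2d`, WITH NO HYPOTHESIS ON `Rb` and no tangent-deviation input.
At the registered output corner (`d = 3hs/4`, `M = 2`) this covers the plateau chords `|s| ≤ 3hs/4` toward the bulk and `|s| ≤ 0.375·hs`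
toward the end (blueprint step 2, first clause).
HONEST FRAMING: bookkeeping for a HYPOTHETICAL filament skeleton on the NEGATIVE side of a MODEL route; the stub `stub_stripPropagation` is NOT
closed by this file; nothing here bears on Navier–Stokes regularity or blow-up.  `--supports stmt-NavierStokesRegularity-23320`.
-/

set_option linter.dupNamespace false

noncomputable section

namespace Summit.NavierStokesRegularity.NavierStokesRegularity.Theorems.StadiumPlateauShortChord

open Set Metric
open Summit.NavierStokesRegularity.NavierStokesRegularity.Theorems.StadiumChordVariance
open Summit.NavierStokesRegularity.NavierStokesRegularity.Theorems.StadiumCauchyNumerator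
open Summit.NavierStokesRegularity.NavierStokesRegularity.Theorems.StadiumPartnerPiece

/-- **Discs about a horizontal chord fit in the stadium.**  If the `d`-discs about both endpoints `z`, `z + s` of a horizontal chord fit
(`|Im z| + d < hs`, `|Re z − cc| + d < L + hs`, `|Re z + s − cc| + d < L + hs`), then the closed `d`-disc about every chord point
`z + r` (`r` between `0` and `s`) lies in the stadium. [folklore] -/
theorem closedBall_chord_subset {hs L cc d : ℝ} {z : ℂ} {s : ℝ}
    (hv : |z.im| + d < hs) (h0 : |z.re - cc| + d < L + hs) (h1 : |z.re + s - cc| + d < L + hs)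
    {r : ℝ} (hr : r ∈ uIcc 0 s) :
    closedBall (z + (r : ℂ)) d ⊆ {w : ℂ | |w.im| < hs ∧ |w.re - cc| < L + hs} := by
  intro w hw
  rw [mem_closedBall, dist_eq_norm] at hw
  have him : |w.im - z.im| ≤ d := by
    have h := Complex.abs_im_le_norm (w - (z + (r : ℂ)))
    simp only [Complex.sub_im, Complex.add_im, Complex.ofReal_im, add_zero] at h
    exact h.trans hw
  have hre : |w.re - (z.re + r)| ≤ d := by
    have h := Complex.abs_re_le_norm (w - (z + (r : ℂ)))
    simp only [Complex.sub_re, Complex.add_re, Complex.ofReal_re] at h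
    exact h.trans hw
  -- the chord's real part is between the endpoints'
  have hmid : |z.re + r - cc| ≤ max (|z.re - cc|) (|z.re + s - cc|) := by
    rcases le_total 0 s with hs0 | hs0
    · rw [uIcc_of_le hs0] at hr
      rw [abs_le]
      constructor
      · have h2 := neg_abs_le (z.re - cc)
        have : -max (|z.re - cc|) (|z.re + s - cc|) ≤ -|z.re - cc| := neg_le_neg (le_max_left _ _)
        linarith [hr.1]
      · have h2 := le_abs_self (z.re + s - cc)
        have : |z.re + s - cc| ≤ max (|z.re - cc|) (|z.re + s - cc|) := le_max_right _ _
        linarith [hr.2]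
    · rw [uIcc_of_ge hs0] at hr
      rw [abs_le]
      constructor
      · have h2 := neg_abs_le (z.re + s - cc)
        have : -max (|z.re - cc|) (|z.re + s - cc|) ≤ -|z.re + s - cc| := neg_le_neg (le_max_right _ _)
        linarith [hr.1]
      · have h2 := le_abs_self (z.re - cc)
        have : |z.re - cc| ≤ max (|z.re - cc|) (|z.re + s - cc|) := le_max_left _ _
        linarith [hr.2]
  have hmax : max (|z.re - cc|) (|z.re + s - cc|) + d < L + hs := by
    rcases le_total (|z.re - cc|) (|z.re + s - cc|) with h | h
    · rw [max_eq_right h]; exact h1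
    · rw [max_eq_left h]; exact h0
  refine ⟨?_, ?_⟩
  · have h3 := abs_le.1 him
    have h4 := le_abs_self z.im
    have h5 := neg_abs_le z.im
    rw [abs_lt]; constructor <;> linarith
  · have h3 := abs_le.1 hre
    have h4 := abs_lt.1 (lt_of_le_of_lt hmid (by linarith : max (|z.re - cc|) (|z.re + s - cc|) < L + hs - d))
    rw [abs_lt]; constructor <;> linarith

/-- **Short plateau chords are on the principal branch, every `Rb`.**  Stadium `S`, `F` holomorphic on `S` with `‖F′‖ ≤ M` and `Σ (F′)ᵢ² = 1`;
a target `z` and a horizontal displacement `s` whose chord has fitting `d`-discs (`0 < d`): then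
`‖Σᵢ (Fᵢ(z+s) − Fᵢ(z))² − s²‖ ≤ (M/d)²/4 · s⁴`. [folklore] -/
theorem plateau_chord_sq_sub_sq_le {hs L cc M d : ℝ} {F : ℂ → (Fin 3 → ℂ)}
    (hF : DifferentiableOn ℂ F {z : ℂ | |z.im| < hs ∧ |z.re - cc| < L + hs})
    (hM : ∀ z ∈ {z : ℂ | |z.im| < hs ∧ |z.re - cc| < L + hs}, ‖deriv F z‖ ≤ M)
    (hunit : ∀ w ∈ {z : ℂ | |z.im| < hs ∧ |z.re - cc| < L + hs}, ∑ i, (deriv F w i) ^ 2 = 1)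
    {z : ℂ} {s : ℝ} (hd : 0 < d)
    (hv : |z.im| + d < hs) (h0 : |z.re - cc| + d < L + hs) (h1 : |z.re + s - cc| + d < L + hs) :
    ‖(∑ i, (F (z + (s : ℂ)) i - F z i) ^ 2) - (s : ℂ) ^ 2‖ ≤ (M / d) ^ 2 / 4 * s ^ 4 := by
  set S : Set ℂ := {z : ℂ | |z.im| < hs ∧ |z.re - cc| < L + hs} with hS
  have hSo : IsOpen S := isOpen_stadium hs (L + hs) cc
  have hball : ∀ r ∈ uIcc 0 s, closedBall (z + (r : ℂ)) d ⊆ S := fun r hr => closedBall_chord_subset hv h0 h1 hr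
  have hseg : ∀ r ∈ uIcc 0 s, z + (r : ℂ) ∈ S := fun r hr => hball r hr (mem_closedBall_self hd.le)
  have hM2 : ∀ r ∈ uIcc 0 s, ‖deriv (deriv F) (z + (r : ℂ))‖ ≤ M / d := fun r hr =>
    norm_deriv_deriv_le_of_closedBall hSo hF hM hd (hball r hr)
  exact chord_sq_sub_sq_norm_le_of_deriv_deriv_real hSo hF hunit hseg hM2

/-- **Principal branch of the matched kernel on short plateau chords.**  Under the hypotheses of `plateau_chord_sq_sub_sq_le`, with a core term
`g₀ ≤ Re Gv`, `0 ≤ κ`: `s²·(1 − (M/d)²s²/4) + κ·g₀ ≤ Re(Σᵢ (Fᵢ(z+s) − Fᵢ(z))² + κ·Gv)`; in particular the real part is positive as soon as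
`M·|s| ≤ 2d`, `0 < κ`, `0 < g₀` — no hypothesis on the tangent oscillation `Rb`. [folklore] -/
theorem plateau_chord_re_ge {hs L cc M d : ℝ} {F : ℂ → (Fin 3 → ℂ)}
    (hF : DifferentiableOn ℂ F {z : ℂ | |z.im| < hs ∧ |z.re - cc| < L + hs})
    (hM : ∀ z ∈ {z : ℂ | |z.im| < hs ∧ |z.re - cc| < L + hs}, ‖deriv F z‖ ≤ M)
    (hunit : ∀ w ∈ {z : ℂ | |z.im| < hs ∧ |z.re - cc| < L + hs}, ∑ i, (deriv F w i) ^ 2 = 1)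
    {z : ℂ} {s : ℝ} (hd : 0 < d)
    (hv : |z.im| + d < hs) (h0 : |z.re - cc| + d < L + hs) (h1 : |z.re + s - cc| + d < L + hs)
    {κ g₀ : ℝ} {Gv : ℂ} (hκ : 0 ≤ κ) (hG : g₀ ≤ Gv.re) :
    s ^ 2 * (1 - (M / d) ^ 2 * s ^ 2 / 4) + κ * g₀ ≤
      ((∑ i, (F (z + (s : ℂ)) i - F z i) ^ 2) + (κ : ℂ) * Gv).re := by
  have h := plateau_chord_sq_sub_sq_le hF hM hunit hd hv h0 h1
  set Q : ℂ := ∑ i, (F (z + (s : ℂ)) i - F z i) ^ 2 with hQ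
  have hre : Q.re = s ^ 2 + (Q - (s : ℂ) ^ 2).re := by
    simp [Complex.sub_re, ← Complex.ofReal_pow]
  have hlow : -((M / d) ^ 2 / 4 * s ^ 4) ≤ (Q - (s : ℂ) ^ 2).re := by
    have h3 := Complex.abs_re_le_norm (Q - (s : ℂ) ^ 2)
    have h4 := neg_abs_le (Q - (s : ℂ) ^ 2).re
    linarith
  rw [Complex.add_re, Complex.re_ofReal_mul, hre]
  have h5 : κ * g₀ ≤ κ * Gv.re := mul_le_mul_of_nonneg_left hG hκ
  have h6 : s ^ 2 * (1 - (M / d) ^ 2 * s ^ 2 / 4) = s ^ 2 - (M / d) ^ 2 / 4 * s ^ 4 := by ring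
  rw [h6]
  linarith

/-- **Positivity form.**  With `M·|s| ≤ 2d`, `0 < κ`, `0 < g₀ ≤ Re Gv`: `0 < Re(Σᵢ (Fᵢ(z+s) − Fᵢ(z))² + κ·Gv)`. [folklore] -/
theorem plateau_chord_re_pos {hs L cc M d : ℝ} {F : ℂ → (Fin 3 → ℂ)}
    (hF : DifferentiableOn ℂ F {z : ℂ | |z.im| < hs ∧ |z.re - cc| < L + hs})
    (hM : ∀ z ∈ {z : ℂ | |z.im| < hs ∧ |z.re - cc| < L + hs}, ‖deriv F z‖ ≤ M)
    (hunit : ∀ w ∈ {z : ℂ | |z.im| < hs ∧ |z.re - cc| < L + hs}, ∑ i, (deriv F w i) ^ 2 = 1)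
    {z : ℂ} {s : ℝ} (hd : 0 < d)
    (hv : |z.im| + d < hs) (h0 : |z.re - cc| + d < L + hs) (h1 : |z.re + s - cc| + d < L + hs)
    (hshort : M * |s| ≤ 2 * d) (hM0 : 0 ≤ M)
    {κ g₀ : ℝ} {Gv : ℂ} (hκ : 0 < κ) (hg₀ : 0 < g₀) (hG : g₀ ≤ Gv.re) :
    0 < ((∑ i, (F (z + (s : ℂ)) i - F z i) ^ 2) + (κ : ℂ) * Gv).re := by
  have h := plateau_chord_re_ge hF hM hunit hd hv h0 h1 hκ.le hG
  have hs2 : (M / d) ^ 2 * s ^ 2 / 4 ≤ 1 := by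
    have h2 : (M * |s|) ^ 2 ≤ (2 * d) ^ 2 := pow_le_pow_left₀ (by positivity) hshort 2
    rw [mul_pow, sq_abs] at h2
    rw [div_pow]
    have hd2 : 0 < d ^ 2 := by positivity
    rw [div_mul_eq_mul_div, div_div, div_le_one (by positivity)]
    nlinarith
  have h3 : 0 ≤ s ^ 2 * (1 - (M / d) ^ 2 * s ^ 2 / 4) := mul_nonneg (sq_nonneg _) (by linarith)
  have h4 : 0 < κ * g₀ := mul_pos hκ hg₀
  linarith

end Summit.NavierStokesRegularity.NavierStokesRegularity.Theorems.StadiumPlateauShortChord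

end
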